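import Literature.AnabelianGeometry.SemiGraphs.TemperedCompactPairUnfoldedInfiniteValence
import Literature.AnabelianGeometry.SemiGraphs.TemperedCompactPairPinnedEntry
import HarnessLib

/-!
# Persistent unfolded fixed branch pairs over ONE level vertex: the EXIT branches leave every finite set

Mochizuki, *Semi-graphs of anabelioids*, Publ. RIMS **42** (2006), §3, Theorem 3.7 (iii)/(iv) pp. 40–41, with
the author's *Comments* (2020) (6)(b) [cite: MochizukiSemiAnbd2006, Thm 3.7(iv) p.41].

PROOF-ONLY tool file (abc-iut cell, layer L3, row «T37iv-S2@RELATIVE-BRIDGE», file F7 — DRAFT for a successor, seat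
abc-iut-L3-t8 gen 10; no definition, no named fact).  Sharpening of F4 (`TemperedCompactPairUnfoldedInfiniteValence`)
and F6 (`TemperedCompactPairPinnedEntry`): for every countable `𝒢` satisfying the hypotheses of Thm 3.7, canonical
tower,

* ★ `false_of_forall_unfolded_mem_finite` — a compact `C ≠ 1` cannot fix, at EVERY level `M ≥ m`, an unfolded branch
  pair over the vertex `z` of `𝒢_{∞,m}` whose two images at `z` stay inside ONE FINITE set of branches (F4's pigeonhole
  with the finite set in place of the whole star);
* ★★ `exists_exit_not_mem_of_pinned_unfolded` — in the residual of the trichotomy with pinned entry `β_A`, for every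
  FINITE set `F` of branches of `𝒢_{∞,m}` some level carries a `C`-fixed unfolded pair over `z` entering over `β_A` and
  EXITING OUTSIDE `F`: the exits are unbounded.

Honest framing: generic statements about OUR typed `π₁^temp`; nothing bears on [IUTchIII] Cor. 3.12; typed ≠ proved.
-/
noncomputable section

open CategoryTheory Topology

namespace Literature.AnabelianGeometry.SemiGraphs

open SimpleGraph

universe u

namespace ProfiniteSemiGraph

variable {𝒢 : ProfiniteSemiGraph.{u}}

/-- ★ **Unfolded `C`-fixed pairs over one level vertex cannot stay inside a finite set of branches.**  Let `C ≠ 1` be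
compact, `z` a vertex of `𝒢_{∞,m}` and `F` a FINITE set of branches of `𝒢_{∞,m}`.  It is impossible that every level
`M ≥ m` carries a vertex over `z` with two `C`-fixed branches (the vertex `C`-fixed too) whose images are DISTINCT
branches at `z` BOTH lying in `F`: each of the finitely many image pairs in the finite level `𝔾_{S m}` is realised at
only finitely many levels (`eventually_no_unfolded_pair_over_temperedPiChart`). [cite: MochizukiSemiAnbd2006, Thm 3.7(iv) p.41] -/
theorem false_of_forall_unfolded_mem_finite (h37 : 𝒢.Thm37Hypotheses)
    (C : Subgroup ((𝒢.galoisLevelData h37.toProp36Hypotheses).temperedPi h37.toProp36Hypotheses.isCountable))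
    (hC : IsCompact (C : Set ((𝒢.galoisLevelData h37.toProp36Hypotheses).temperedPi h37.toProp36Hypotheses.isCountable))) (hC1 : C ≠ ⊥) (m : ℕ) (z : ((𝒢.galoisLevelData h37.toProp36Hypotheses).tree m).Vertex)
    (F : Set ((𝒢.galoisLevelData h37.toProp36Hypotheses).tree m).Branch) (hF : F.Finite)
    (hunf : ∀ (M : ℕ) (hmM : m ≤ M),
      ∃ (w : ((𝒢.galoisLevelData h37.toProp36Hypotheses).tree M).Vertex) (β β' : ((𝒢.galoisLevelData h37.toProp36Hypotheses).tree M).Branch),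
        ((𝒢.galoisLevelData h37.toProp36Hypotheses).tree M).abuts β = some w ∧ ((𝒢.galoisLevelData h37.toProp36Hypotheses).tree M).abuts β' = some w ∧
        ((𝒢.galoisLevelData h37.toProp36Hypotheses).treeTrans hmM).vertexMap w = z ∧
        ((𝒢.galoisLevelData h37.toProp36Hypotheses).treeTrans hmM).branchMap β ≠ ((𝒢.galoisLevelData h37.toProp36Hypotheses).treeTrans hmM).branchMap β' ∧
        ((𝒢.galoisLevelData h37.toProp36Hypotheses).treeTrans hmM).branchMap β ∈ F ∧ ((𝒢.galoisLevelData h37.toProp36Hypotheses).treeTrans hmM).branchMap β' ∈ F ∧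
        ∀ g ∈ C,
          ((𝒢.galoisLevelData h37.toProp36Hypotheses).treeAct h37.toProp36Hypotheses.isCountable M g).hom.vertexMap w = w ∧
          ((𝒢.galoisLevelData h37.toProp36Hypotheses).treeAct h37.toProp36Hypotheses.isCountable M g).hom.branchMap β = β ∧
          ((𝒢.galoisLevelData h37.toProp36Hypotheses).treeAct h37.toProp36Hypotheses.isCountable M g).hom.branchMap β' = β') :
    False := by
  classical
  let h36 := h37.toProp36Hypotheses
  let G := 𝒢.galoisLevelData h36
  have hc := h36.isCountable
  let L := (G.S m).orbitGraph
  let q : G.tree m ⟶ L := G.treeQuot m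
  let w₀ : L.Vertex := q.vertexMap z
  let Q : Set (L.Branch × L.Branch) := (q.branchMap '' F) ×ˢ (q.branchMap '' F)
  have hQ : Q.Finite := (hF.image _).prod (hF.image _)
  have hB := fun (τ : L.Branch × L.Branch) (hτ : τ.1 ≠ τ.2) =>
    eventually_no_unfolded_pair_over_temperedPiChart h37 C hC hC1 m w₀ τ.1 τ.2 hτ
  let kk : L.Branch × L.Branch → ℕ := fun τ => if hτ : τ.1 ≠ τ.2 then (hB τ hτ).choose else m
  have hkk : ∀ τ (hτ : τ.1 ≠ τ.2), ∃ h₀ : m ≤ kk τ, ∀ (k : ℕ) (hk : kk τ ≤ k),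
      ¬ ∃ (w : (G.tree k).Vertex) (cc cc' : (G.tree k).Branch), cc ≠ cc' ∧
        (G.tree k).abuts cc = some w ∧ (G.tree k).abuts cc' = some w ∧
        (∀ g ∈ C, (G.treeAct hc k g).hom.vertexMap w = w ∧ (G.treeAct hc k g).hom.branchMap cc = cc ∧
          (G.treeAct hc k g).hom.branchMap cc' = cc') ∧
        (G.levelTrans (h₀.trans hk)).vertexMap ((G.treeQuot k).vertexMap w) = w₀ ∧
        (G.levelTrans (h₀.trans hk)).branchMap ((G.treeQuot k).branchMap cc) = τ.1 ∧
        (G.levelTrans (h₀.trans hk)).branchMap ((G.treeQuot k).branchMap cc') = τ.2 := by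
    intro τ hτ
    have hdef : kk τ = (hB τ hτ).choose := dif_pos hτ
    obtain ⟨h₀, hspec⟩ := (hB τ hτ).choose_spec
    rw [hdef]
    exact ⟨h₀, fun k hk => hspec k hk⟩
  obtain ⟨K, hK⟩ := (hQ.image kk).bddAbove
  let k : ℕ := max m K
  have hmk : m ≤ k := le_max_left _ _
  obtain ⟨w, β, β', hβw, hβ'w, hwz, hne, hβF, hβ'F, hfix⟩ := hunf k hmk
  let π := G.treeTrans hmk
  let τ₀ : L.Branch × L.Branch := (q.branchMap (π.branchMap β), q.branchMap (π.branchMap β'))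
  have hπβ : (G.tree m).abuts (π.branchMap β) = some z := by rw [π.abuts_branchMap β w hβw, hwz]
  have hπβ' : (G.tree m).abuts (π.branchMap β') = some z := by rw [π.abuts_branchMap β' w hβ'w, hwz]
  have hτ₀Q : τ₀ ∈ Q := Set.mk_mem_prod ⟨_, hβF, rfl⟩ ⟨_, hβ'F, rfl⟩
  have hτ₀ : τ₀.1 ≠ τ₀.2 := by
    intro h
    apply hne
    have hinj := G.treeQuot_isImmersion m z
    have h' : SemiGraph.Hom.starMap q z ⟨π.branchMap β, hπβ⟩ = SemiGraph.Hom.starMap q z ⟨π.branchMap β', hπβ'⟩ :=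
      Subtype.ext h
    exact congrArg Subtype.val (hinj h')
  obtain ⟨h₀, hno⟩ := hkk τ₀ hτ₀
  have hkK : kk τ₀ ≤ k := (hK ⟨τ₀, hτ₀Q, rfl⟩).trans (le_max_right _ _)
  refine hno k hkK ⟨w, β, β', fun h => hne (by rw [h]), hβw, hβ'w, hfix, ?_, ?_, ?_⟩
  · have e := congrArg (fun ψ => SemiGraph.Hom.vertexMap ψ w) (G.treeTrans_quot hmk)
    simp only [SemiGraph.comp_vertexMap, Function.comp_apply] at e
    rw [← e, hwz]
  · have e := congrArg (fun ψ => SemiGraph.Hom.branchMap ψ β) (G.treeTrans_quot hmk)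
    simp only [SemiGraph.comp_branchMap, Function.comp_apply] at e
    rw [← e]
  · have e := congrArg (fun ψ => SemiGraph.Hom.branchMap ψ β') (G.treeTrans_quot hmk)
    simp only [SemiGraph.comp_branchMap, Function.comp_apply] at e
    rw [← e]

/-- ★★ **In the pinned residual the EXIT branches leave every finite set.**  Let `C ≠ 1` be compact, `z` a vertex of
`𝒢_{∞,m}`, `β_A` a branch at `z`, and suppose every level `M ≥ m` carries a vertex over `z` with two `C`-fixed
branches (vertex `C`-fixed too), one over `β_A` and one over a branch `≠ β_A` (the second alternative of
`anchored_or_pinned_unfolded_of_not_isCompact` with `C = K₁ ⊓ K₂`).  Then for every FINITE set `F` of branches of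
`𝒢_{∞,m}` some level `M ≥ m` carries such a pair whose EXIT lies OUTSIDE `F`. [cite: MochizukiSemiAnbd2006, Thm 3.7(iv) p.41] -/
theorem exists_exit_not_mem_of_pinned_unfolded (h37 : 𝒢.Thm37Hypotheses)
    (C : Subgroup ((𝒢.galoisLevelData h37.toProp36Hypotheses).temperedPi h37.toProp36Hypotheses.isCountable))
    (hC : IsCompact (C : Set ((𝒢.galoisLevelData h37.toProp36Hypotheses).temperedPi h37.toProp36Hypotheses.isCountable))) (hC1 : C ≠ ⊥) (m : ℕ) (z : ((𝒢.galoisLevelData h37.toProp36Hypotheses).tree m).Vertex)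
    (βA : ((𝒢.galoisLevelData h37.toProp36Hypotheses).tree m).Branch)
    (hunf : ∀ (M : ℕ) (hmM : m ≤ M),
      ∃ (w : ((𝒢.galoisLevelData h37.toProp36Hypotheses).tree M).Vertex) (β β' : ((𝒢.galoisLevelData h37.toProp36Hypotheses).tree M).Branch),
        ((𝒢.galoisLevelData h37.toProp36Hypotheses).tree M).abuts β = some w ∧ ((𝒢.galoisLevelData h37.toProp36Hypotheses).tree M).abuts β' = some w ∧
        ((𝒢.galoisLevelData h37.toProp36Hypotheses).treeTrans hmM).vertexMap w = z ∧
        ((𝒢.galoisLevelData h37.toProp36Hypotheses).treeTrans hmM).branchMap β = βA ∧ ((𝒢.galoisLevelData h37.toProp36Hypotheses).treeTrans hmM).branchMap β' ≠ βA ∧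
        ∀ g ∈ C,
          ((𝒢.galoisLevelData h37.toProp36Hypotheses).treeAct h37.toProp36Hypotheses.isCountable M g).hom.vertexMap w = w ∧
          ((𝒢.galoisLevelData h37.toProp36Hypotheses).treeAct h37.toProp36Hypotheses.isCountable M g).hom.branchMap β = β ∧
          ((𝒢.galoisLevelData h37.toProp36Hypotheses).treeAct h37.toProp36Hypotheses.isCountable M g).hom.branchMap β' = β')
    (F : Set ((𝒢.galoisLevelData h37.toProp36Hypotheses).tree m).Branch) (hF : F.Finite) :
    ∃ (M : ℕ) (hmM : m ≤ M) (w : ((𝒢.galoisLevelData h37.toProp36Hypotheses).tree M).Vertex) (β β' : ((𝒢.galoisLevelData h37.toProp36Hypotheses).tree M).Branch),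
      ((𝒢.galoisLevelData h37.toProp36Hypotheses).tree M).abuts β = some w ∧ ((𝒢.galoisLevelData h37.toProp36Hypotheses).tree M).abuts β' = some w ∧
      ((𝒢.galoisLevelData h37.toProp36Hypotheses).treeTrans hmM).vertexMap w = z ∧
      ((𝒢.galoisLevelData h37.toProp36Hypotheses).treeTrans hmM).branchMap β = βA ∧ ((𝒢.galoisLevelData h37.toProp36Hypotheses).treeTrans hmM).branchMap β' ∉ F ∧
      ∀ g ∈ C,
        ((𝒢.galoisLevelData h37.toProp36Hypotheses).treeAct h37.toProp36Hypotheses.isCountable M g).hom.vertexMap w = w ∧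
        ((𝒢.galoisLevelData h37.toProp36Hypotheses).treeAct h37.toProp36Hypotheses.isCountable M g).hom.branchMap β = β ∧
        ((𝒢.galoisLevelData h37.toProp36Hypotheses).treeAct h37.toProp36Hypotheses.isCountable M g).hom.branchMap β' = β' := by
  classical
  by_contra hall
  refine false_of_forall_unfolded_mem_finite h37 C hC hC1 m z (insert βA F) (hF.insert βA) fun M hmM => ?_
  obtain ⟨w, β, β', hβw, hβ'w, hwz, hin, hout, hfix⟩ := hunf M hmM
  have hβ'F : ((𝒢.galoisLevelData h37.toProp36Hypotheses).treeTrans hmM).branchMap β' ∈ F := by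
    by_contra h
    exact hall ⟨M, hmM, w, β, β', hβw, hβ'w, hwz, hin, h, hfix⟩
  refine ⟨w, β, β', hβw, hβ'w, hwz, ?_, ?_, Set.mem_insert_of_mem _ hβ'F, hfix⟩
  · rw [hin]; exact hout.symm
  · rw [hin]; exact Set.mem_insert _ _

end ProfiniteSemiGraph

end Literature.AnabelianGeometry.SemiGraphs

end
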